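import Summits.QuantumFields.YangMills.Theorems.DiagonalMirrorRPRCubeHalfRPGeometry
import Literature.MathematicalPhysics.QuantumFieldTheory.TiltedTorusSwapRP

/-!
# Crux `WeakCouplingHypercubicLimitRP` (stmt-QuantumFields-27398), line `Sketch`, stub D1′ `stub_oddTorusSwapPairingLiminf`, door C
# (`cube-surgery-decoupling`, card #114), S1a part 2/4: the SWAP on links and the SPLIT of the free-cube action

Helper file (`--supports stmt-QuantumFields-27398 --as helper`) of the crux lead `lead-27398-D1` (gen 2); part 2 of the proof of S1a
`cubeHalfRP : CubeHalfRP G` (continues `…DiagonalMirrorRPRCubeHalfRPGeometry`).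

WHAT.  The configuration swap is the tree's `configPerm (0 1)` (`LatticeGaugeStaticPotentialProofs` §(B)): it FIXES the shared links
(`configPerm_swap_apply_of_mem_M`) and the image of a positive link is never positive (`dependsOn_configPerm_swap_apply` — the `P`-coordinates
of `Θ U` depend on `U` off `P`), links of the closed positive half-cube lie in `P ∪ ∅ ∪ M`.  The action: `Re tr ρ((Θ U)_p) = Re tr ρ(U_{τ p})`
(`re_trace_hol_configPerm_swap`; the `(0,1)`-plaquette at `θx` is traversed backwards, `plaquetteHolonomy_swap` + unitarity), hence the
negative part of the free-cube action is the positive part at the swapped configuration and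
**`cubeAction_split`**: `S_{Q_R}(U) = N·#Q_R − (X_cut(U) + X_sh(U) + X_pos(U) + X_pos(Θ U))`; the positive part depends only on closed-positive
links, the shared part only on shared links and is swap invariant; bounds `|X_A| ≤ N·#A` and measurability of every piece without second
countability of `G` (entry-measurability, `TiltedTorusRP.entryMeasurable_*`), including `measurable_cubeAction`.

HONEST FRAMING: bookkeeping for an exact finite-volume identity (S1a `cubeHalfRP`, file `…DiagonalMirrorRPRCubeHalfRP`); nothing asymptotic,
no letter of door B or C is proved; D1′, ⟨27398⟩ and its heart S6i are OPEN; nothing here bears on the summit; the Yang–Mills mass gap is NOT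
proved here or anywhere in the tree.  Definition-free (bookkeeping objects are parameters constrained by defining equations, sub-namespace
`HalfRP`); no instance, no notation, `autoImplicit false`.

References: J. Fröhlich, R. Israel, E. H. Lieb, B. Simon, Comm. Math. Phys. 62 (1978) 1, Thm 2.1; K. Osterwalder, E. Seiler, Ann. Phys. 110
(1978) 440, §2; E. Seiler, LNP 159 (1982) Ch. 2.
-/

set_option autoImplicit false

noncomputable section

open scoped SchwartzMap ComplexConjugate ComplexOrder
open MeasureTheory Filter Topology Finset Complex
open Literature.MathematicalPhysics.QuantumLattice Literature.MathematicalPhysics.AQFT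
  Literature.MathematicalPhysics.QuantumFieldTheory
open Literature.Probability.LatticeModels (box)
open Summit.QuantumFields.YangMills.Cruxes.DiagonalMirrorRPR.ParityBridgeColdTraces (E4)

namespace Summit.QuantumFields.YangMills.Cruxes.DiagonalMirrorRPR.CubeSurgery

namespace HalfRP

/-! ## §3 (continued) Bookkeeping objects as constrained parameters -/

section Param

variable {G : Type} [Group G] [MeasurableSpace G] {S : ℕ} [NeZero S] {R : ℕ} (hRS : 2 * R + 1 ≤ S)
  {d : {q : Fin 4 × Fin 4 // q.1 < q.2} → {q : Fin 4 × Fin 4 // q.1 < q.2}}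
  {τ : Plaquette 4 S → Plaquette 4 S}
  {M P : Finset (Edge 4 S)} {cube cut sh pos neg : Finset (Plaquette 4 S)}

variable
  (hd : ∀ q, (d q).1 = if q.1 = ((0 : Fin 4), (1 : Fin 4)) then q.1
    else (Equiv.swap (0 : Fin 4) 1 q.1.1, Equiv.swap (0 : Fin 4) 1 q.1.2))
  (hτ : ∀ p, τ p = (sitePerm (Equiv.swap (0 : Fin 4) 1) p.1, d p.2))
  (hM : ∀ e, e ∈ M ↔ PosHalfEdge S R e ∧ (e.2 = 2 ∨ e.2 = 3) ∧ rep S e.1 0 = rep S e.1 1)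
  (hP : ∀ e, e ∈ P ↔ PosHalfEdge S R e ∧ e ∉ M)
  (hcube : ∀ p, p ∈ cube ↔ PlaqInCube S R p)
  (hcut : ∀ p, p ∈ cut ↔ PlaqInCube S R p ∧ p.2.1 = (0, 1) ∧ rep S p.1 0 = rep S p.1 1)
  (hsh : ∀ p, p ∈ sh ↔ PlaqInCube S R p ∧ p.2.1 = (2, 3) ∧ rep S p.1 0 = rep S p.1 1)
  (hpos : ∀ p, p ∈ pos ↔ PlaqInCube S R p ∧
    ((p.2.1.1 = 0 ∧ p.2.1.2 = 1 ∧ 1 ≤ rep S p.1 0 - rep S p.1 1) ∨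
      (p.2.1.1 = 0 ∧ (p.2.1.2 = 2 ∨ p.2.1.2 = 3) ∧ 0 ≤ rep S p.1 0 - rep S p.1 1) ∨
      (p.2.1.1 = 1 ∧ 1 ≤ rep S p.1 0 - rep S p.1 1) ∨ (p.2.1.1 = 2 ∧ 1 ≤ rep S p.1 0 - rep S p.1 1)))
  (hneg : neg = cube \ (cut ∪ sh ∪ pos))

/-! ### The swap on links: shared links are fixed, positive links go to the open negative half -/

section Swap

include hM in
omit [NeZero S] in
/-- Shared links lie in the closed positive half-cube. -/
theorem posHalf_of_mem_M {e : Edge 4 S} (he : e ∈ M) : PosHalfEdge S R e := ((hM e).1 he).1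

include hP in
omit [NeZero S] in
/-- The positive block `P` is disjoint from the shared block `M`. -/
theorem disjoint_positive_shared : Disjoint P M := by
  rw [Finset.disjoint_left]; intro e hp he; exact ((hP e).1 hp).2 he

include hP in
omit [NeZero S] in
/-- A link of the closed positive half-cube lies in `P ∪ ∅ ∪ M`. -/
theorem mem_union_of_posHalf {e : Edge 4 S} (he : PosHalfEdge S R e) : e ∈ P ∪ ∅ ∪ M := by
  rw [Finset.union_empty, Finset.mem_union, hP]
  by_cases h : e ∈ M
  · exact Or.inr h
  · exact Or.inl ⟨he, h⟩

include hP in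
omit [Group G] [MeasurableSpace G] [NeZero S] in
/-- A function of the closed positive half-cube links depends only on `P ∪ ∅ ∪ M`. -/
theorem dependsOn_union_of_posHalf {β : Type*} {f : GaugeConfig 4 S G → β}
    (hf : DependsOn f {e : Edge 4 S | PosHalfEdge S R e}) : DependsOn f ((P ∪ ∅ ∪ M : Finset (Edge 4 S)) : Set (Edge 4 S)) :=
  fun _ _ hUV => hf fun e he => hUV e (Finset.mem_coe.2 (mem_union_of_posHalf hP he))

omit [Group G] [NeZero S] in
/-- The swap on configurations, evaluated: `(Θ U)(x, i) = U(θx, σ i)`. -/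
theorem configPerm_swap_apply (U : GaugeConfig 4 S G) (e : Edge 4 S) :
    configPerm (Equiv.swap (0 : Fin 4) 1) U e = U (sitePerm (Equiv.swap (0 : Fin 4) 1) e.1, Equiv.swap (0 : Fin 4) 1 e.2) := by
  rw [configPerm_apply, Equiv.symm_swap]

include hM in
omit [Group G] [NeZero S] in
/-- **The swap fixes the shared links.** -/
theorem configPerm_swap_apply_of_mem_M (U : GaugeConfig 4 S G) (e : Edge 4 S) (he : e ∈ M) :
    configPerm (Equiv.swap (0 : Fin 4) 1) U e = U e := by
  obtain ⟨-, h23, hv⟩ := (hM e).1 he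
  rw [configPerm_swap_apply, sitePerm_swap_eq_self_of_rep hv]
  obtain ⟨x, i⟩ := e
  simp only at h23 ⊢
  rcases h23 with h | h <;> subst h <;> simp [Equiv.swap_apply_of_ne_of_ne]

include hM hP in
omit [Group G] in
/-- **The swap of a positive link is not positive**: the `P`-coordinate `e` of `Θ U` depends only on `U` off `P`. -/
theorem dependsOn_configPerm_swap_apply (e : Edge 4 S) (he : e ∈ P ∪ (∅ : Finset (Edge 4 S))) :
    DependsOn (fun U : GaugeConfig 4 S G => configPerm (Equiv.swap (0 : Fin 4) 1) U e)
      (((Pᶜ : Finset (Edge 4 S)) : Set (Edge 4 S))) := by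
  intro U V hUV
  rw [Finset.union_empty] at he
  obtain ⟨hpe, hnM⟩ := (hP e).1 he
  simp only [configPerm_swap_apply]
  apply hUV
  rw [Finset.coe_compl, Set.mem_compl_iff, Finset.mem_coe, hP]
  intro hcon
  obtain ⟨hpe', -⟩ := hcon
  apply hnM
  rw [hM]
  refine ⟨hpe, ?_⟩
  obtain ⟨-, -, hv, hvd⟩ := hpe
  obtain ⟨-, -, hv', hvd'⟩ := hpe'
  simp only [rep_sitePerm_swap, Equiv.swap_apply_left, Equiv.swap_apply_right] at hv' hvd'
  obtain ⟨x, i⟩ := e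
  simp only at hv hvd hv' hvd' ⊢
  fin_cases i <;> simp [dv, Equiv.swap_apply_of_ne_of_ne] at hvd hvd' ⊢ <;> omega

end Swap

/-! ### The free-cube action split into cut, shared, positive and negative parts -/

section Action

variable {N : ℕ} (ρ : G →* Matrix (Fin N) (Fin N) ℂ)

include hd hτ in
omit [NeZero S] in
/-- **`Θ`-covariance of the plaquette function**: `Re tr ρ((Θ U)_p) = Re tr ρ(U_{τ p})`. -/
theorem re_trace_hol_configPerm_swap (hu : ∀ g, ρ g ∈ Matrix.unitaryGroup (Fin N) ℂ) (U : GaugeConfig 4 S G)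
    (p : Plaquette 4 S) :
    (ρ (plaquetteHolonomy (configPerm (Equiv.swap (0 : Fin 4) 1) U) p.1 p.2.1.1 p.2.1.2)).trace.re =
      (ρ (plaquetteHolonomy U (τ p).1 (τ p).2.1.1 (τ p).2.1.2)).trace.re := by
  rw [plaquetteHolonomy_configPerm, Equiv.symm_swap, hτ]
  have h1 := hd p.2
  dsimp only
  rcases plane_cases p.2 with h | h | h | h | h | h <;>
    · rw [h] at h1 ⊢
      simp at h1
      simp only [h1, Fin.isValue, Equiv.swap_apply_left, Equiv.swap_apply_right]
      first
        | rfl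
        | (rw [plaquetteHolonomy_swap U _ 0 1, TiltedTorusRP.re_trace_map_inv ρ hu])

include hd hτ hcube hcut hsh hpos hneg in
omit [NeZero S] in
/-- The negative part of the action is the positive part of the swapped configuration. -/
theorem sum_neg_eq_sum_pos_configPerm_swap (hu : ∀ g, ρ g ∈ Matrix.unitaryGroup (Fin N) ℂ) (U : GaugeConfig 4 S G) :
    ∑ p ∈ neg, (ρ (plaquetteHolonomy U p.1 p.2.1.1 p.2.1.2)).trace.re =
      ∑ p ∈ pos, (ρ (plaquetteHolonomy (configPerm (Equiv.swap (0 : Fin 4) 1) U) p.1 p.2.1.1 p.2.1.2)).trace.re := by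
  refine Finset.sum_equiv (Function.Involutive.toPerm τ (τ_τ hd hτ))
    (fun p => mem_neg_iff_τ_mem_pos hd hτ hcube hcut hsh hpos hneg p) (fun p _ => ?_)
  show _ = (ρ (plaquetteHolonomy (configPerm (Equiv.swap (0 : Fin 4) 1) U) (τ p).1 (τ p).2.1.1 (τ p).2.1.2)).trace.re
  rw [re_trace_hol_configPerm_swap hd hτ ρ hu U (τ p), τ_τ hd hτ]

include hd hτ hcube hcut hsh hpos hneg in
/-- **The split of the free-cube action**:
`S_{Q_R}(U) = N · #Q_R − (X_cut(U) + X_sh(U) + X_pos(U) + X_pos(Θ U))`. -/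
theorem cubeAction_split (hu : ∀ g, ρ g ∈ Matrix.unitaryGroup (Fin N) ℂ) (U : GaugeConfig 4 S G) :
    cubeAction ρ S R U = (N : ℝ) * cube.card -
      (∑ p ∈ cut, (ρ (plaquetteHolonomy U p.1 p.2.1.1 p.2.1.2)).trace.re +
        ∑ p ∈ sh, (ρ (plaquetteHolonomy U p.1 p.2.1.1 p.2.1.2)).trace.re +
        ∑ p ∈ pos, (ρ (plaquetteHolonomy U p.1 p.2.1.1 p.2.1.2)).trace.re +
        ∑ p ∈ pos, (ρ (plaquetteHolonomy (configPerm (Equiv.swap (0 : Fin 4) 1) U) p.1 p.2.1.1 p.2.1.2)).trace.re) := by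
  classical
  have hcube' : cube = Finset.univ.filter fun p => PlaqInCube S R p := by
    ext p; rw [hcube, Finset.mem_filter]; simp
  have h0 : cubeAction ρ S R U = ∑ p ∈ cube, ((N : ℝ) - (ρ (plaquetteHolonomy U p.1 p.2.1.1 p.2.1.2)).trace.re) := by
    rw [hcube', Finset.sum_filter]
    unfold cubeAction
    congr 1
  rw [h0, Finset.sum_sub_distrib, Finset.sum_const, nsmul_eq_mul, mul_comm,
    ← Finset.sum_sdiff (union_subset_cube hcube hcut hsh hpos), ← hneg,
    Finset.sum_union (cube_classes_disjoint hcut hsh hpos).2, Finset.sum_union (cube_classes_disjoint hcut hsh hpos).1,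
    sum_neg_eq_sum_pos_configPerm_swap hd hτ hcube hcut hsh hpos hneg ρ hu U]
  ring


include hRS hpos in
omit [MeasurableSpace G] in
/-- The positive part of the action depends only on the links of the closed positive half-cube. -/
theorem dependsOn_sum_pos :
    DependsOn (fun U : GaugeConfig 4 S G => ∑ p ∈ pos, (ρ (plaquetteHolonomy U p.1 p.2.1.1 p.2.1.2)).trace.re)
      {e : Edge 4 S | PosHalfEdge S R e} := by
  intro U V hUV
  refine Finset.sum_congr rfl fun p hp => ?_
  obtain ⟨h1, h2, h3, h4⟩ := edges_of_mem_pos hRS hpos hp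
  simp only [plaquetteHolonomy]
  rw [hUV _ h1, hUV _ h2, hUV _ h3, hUV _ h4]

include hRS hM hsh in
omit [MeasurableSpace G] in
/-- The shared part of the action depends only on the shared links. -/
theorem dependsOn_sum_sh :
    DependsOn (fun U : GaugeConfig 4 S G => ∑ p ∈ sh, (ρ (plaquetteHolonomy U p.1 p.2.1.1 p.2.1.2)).trace.re)
      ((M : Finset (Edge 4 S)) : Set (Edge 4 S)) := by
  intro U V hUV
  refine Finset.sum_congr rfl fun p hp => ?_
  obtain ⟨h1, h2, h3, h4⟩ := edges_of_mem_sh hRS hM hsh hp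
  simp only [plaquetteHolonomy]
  rw [hUV _ (Finset.mem_coe.2 h1), hUV _ (Finset.mem_coe.2 h2), hUV _ (Finset.mem_coe.2 h3),
    hUV _ (Finset.mem_coe.2 h4)]

include hRS hM hsh in
/-- The shared part of the action is swap invariant (its links are fixed by the swap). -/
theorem sum_sh_configPerm_swap (U : GaugeConfig 4 S G) :
    ∑ p ∈ sh, (ρ (plaquetteHolonomy (configPerm (Equiv.swap (0 : Fin 4) 1) U) p.1 p.2.1.1 p.2.1.2)).trace.re =
      ∑ p ∈ sh, (ρ (plaquetteHolonomy U p.1 p.2.1.1 p.2.1.2)).trace.re := by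
  refine Finset.sum_congr rfl fun p hp => ?_
  obtain ⟨h1, h2, h3, h4⟩ := edges_of_mem_sh hRS hM hsh hp
  simp only [plaquetteHolonomy]
  rw [configPerm_swap_apply_of_mem_M hM U _ h1, configPerm_swap_apply_of_mem_M hM U _ h2,
    configPerm_swap_apply_of_mem_M hM U _ h3, configPerm_swap_apply_of_mem_M hM U _ h4]

omit [MeasurableSpace G] [NeZero S] in
/-- `|∑_{p ∈ A} Re tr ρ(U_p)| ≤ N · #A` for a unitary representation. -/
theorem abs_sum_re_trace_le (hu : ∀ g, ρ g ∈ Matrix.unitaryGroup (Fin N) ℂ) (A : Finset (Plaquette 4 S))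
    (U : GaugeConfig 4 S G) :
    |∑ p ∈ A, (ρ (plaquetteHolonomy U p.1 p.2.1.1 p.2.1.2)).trace.re| ≤ (N : ℝ) * A.card := by
  calc |∑ p ∈ A, (ρ (plaquetteHolonomy U p.1 p.2.1.1 p.2.1.2)).trace.re|
      ≤ ∑ p ∈ A, |(ρ (plaquetteHolonomy U p.1 p.2.1.1 p.2.1.2)).trace.re| := Finset.abs_sum_le_sum_abs _ _
    _ ≤ ∑ _p ∈ A, (N : ℝ) := Finset.sum_le_sum fun _ _ => TiltedTorusRP.abs_re_trace_le ρ hu _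
    _ = (N : ℝ) * A.card := by rw [Finset.sum_const, nsmul_eq_mul, mul_comm]

section Meas

variable [TopologicalSpace G] [BorelSpace G] [IsTopologicalGroup G]

omit [NeZero S] in
/-- `Re tr ρ(U_p)` is measurable in the configuration (continuous `ρ`; no second countability needed). -/
theorem measurable_re_trace_hol (hρ : Continuous ρ) (x : Site 4 S) (i j : Fin 4) :
    Measurable fun U : GaugeConfig 4 S G => (ρ (plaquetteHolonomy U x i j)).trace.re := by
  unfold plaquetteHolonomy
  exact TiltedTorusRP.measurable_re_trace ρ
    (TiltedTorusRP.entryMeasurable_mul ρ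
      (TiltedTorusRP.entryMeasurable_mul ρ
        (TiltedTorusRP.entryMeasurable_mul ρ (TiltedTorusRP.entryMeasurable_apply ρ hρ _)
          (TiltedTorusRP.entryMeasurable_apply ρ hρ _))
        (TiltedTorusRP.entryMeasurable_apply_inv ρ hρ _))
      (TiltedTorusRP.entryMeasurable_apply_inv ρ hρ _))

omit [NeZero S] in
/-- Sums of `Re tr ρ(U_p)` over a set of plaquettes are measurable. -/
theorem measurable_sum_re_trace_hol (hρ : Continuous ρ) (A : Finset (Plaquette 4 S)) :
    Measurable fun U : GaugeConfig 4 S G => ∑ p ∈ A, (ρ (plaquetteHolonomy U p.1 p.2.1.1 p.2.1.2)).trace.re :=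
  Finset.measurable_sum _ fun _ _ => measurable_re_trace_hol ρ hρ _ _ _

/-- The free-cube action is measurable. -/
theorem measurable_cubeAction (hρ : Continuous ρ) : Measurable (cubeAction (G := G) ρ S R) := by
  unfold cubeAction
  refine Finset.measurable_sum _ fun p _ => ?_
  by_cases h : PlaqInCube S R p
  · simp only [h, ↓reduceIte]
    exact measurable_const.sub (measurable_re_trace_hol ρ hρ _ _ _)
  · simp only [h, ↓reduceIte]
    exact measurable_const

end Meas

end Action

end Param

end HalfRP

end Summit.QuantumFields.YangMills.Cruxes.DiagonalMirrorRPR.CubeSurgery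

end
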